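import Literature.MathematicalPhysics.QuantumLattice.GibbsVariationalPrinciple
import Literature.MathematicalPhysics.QuantumLattice.DuhamelTwoPoint
import HarnessLib

/-!
# The near-optimal entropy witness: `S(ρ) = inf_G [Re tr(ρG) + log Tr e^{−G}]` over Hermitian `G`

Topic `Literature/MathematicalPhysics/QuantumLattice`; companion of `GibbsVariationalPrinciple.lean`, which proves Gibbs'
inequality `S(ρ) − β Re tr(ρH) ≤ log Re Z_β(H)` for every density matrix `ρ` and Hermitian `H` — i.e. every Hermitian
WITNESS `G` gives an upper bound `S(ρ) ≤ Re tr(ρG) + log Re Tr e^{−G}` (the form in which the `T > 0` certificates of the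
Hubbard cell carry entropy: row families `ent`/`cent`, and the entropy row of the thermal torus-limit states,
`TorusSectorGibbsEntropyRow*`, `HubbardTTPrimeGrandCanonicalThermalStatesEntropyRow`). This file proves the converse
direction needed to turn witness-form rows into statements about the von Neumann entropy itself:

* `Matrix.exists_isHermitian_witness_le_vonNeumannEntropy_add` — for a density matrix `ρ` and every `ε > 0` there is a
  Hermitian `G` with `Re tr(ρG) + log Re Tr e^{−G} ≤ S(ρ) + ε` (in an eigenbasis of `ρ`: `G = −log ρ` on the support,
  a large constant `M` off it; `Re tr(ρG) = S(ρ)` exactly, `Tr e^{−G} ≤ 1 + |n| e^{−M}`);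
* `Matrix.le_vonNeumannEntropy_of_forall_witness` — a bound `c ≤ Re tr(ρG) + log Re Tr e^{−G}` valid for ALL Hermitian
  `G` is a bound `c ≤ S(ρ)`; `Matrix.vonNeumannEntropy_le_witness` — the `β = 1` reading of Gibbs' inequality.

Everything is PROVED; no definition, no named fact.

## Mathlib / tree search

REUSED: `Matrix.IsHermitian.vonNeumannEntropy_sub_mul_le_log_partitionFn` (`GibbsVariationalPrinciple`);
`IsHermitian.eq_conj_diagonal`, `trace_unitary_conj_mul`, `partitionFn_unitary_conj` (`DuhamelTwoPoint`); `vonNeumannEntropy_eq`,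
`sum_eigenvalues_eq_one` (`Literature/InformationTheory/Entropy/VonNeumannEntropy`); Mathlib `Matrix.exp_diagonal`,
`Matrix.isHermitian_diagonal_of_self_adjoint`, `Matrix.isHermitian_mul_mul_conjTranspose`, `Real.negMulLog`, `Real.log_le_sub_one_of_pos`.
`lean search 'witness.*vonNeumannEntropy|vonNeumannEntropy_eq_iInf|le_vonNeumannEntropy_of_forall'`: nothing (2026-08-27).

## References

* M. A. Nielsen, I. L. Chuang, *Quantum Computation and Quantum Information* (2010), §11.3 eq. (11.40), Thm. 11.8.
  [cite: NielsenChuang2010, §11.3 eq. (11.40)]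
* S. J. Gustafson, I. M. Sigal, *Mathematical Concepts of Quantum Mechanics* (2003), §18.3 (18.12)–(18.13) (Gibbs'
  variational principle). [cite: GustafsonSigal2003, §18.3 (18.12)–(18.13)]
-/

noncomputable section

open scoped ComplexOrder BigOperators
open Finset Literature.InformationTheory.Entropy

/-! ### §1 The near-optimal entropy witness of a density matrix -/

namespace Matrix

variable {n : Type*} [Fintype n] [DecidableEq n]

/-- The Gibbs weight of a real diagonal matrix is the diagonal of Boltzmann factors. [folklore] -/
private theorem gibbsWeight_diagonal' (β : ℝ) (E : n → ℝ) :
    gibbsWeight β (diagonal fun i => (E i : ℂ)) = diagonal fun i => (Real.exp (-(β * E i)) : ℂ) := by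
  unfold gibbsWeight
  have h : -(β : ℂ) • diagonal (fun i => (E i : ℂ)) = diagonal fun i => ((-(β * E i) : ℝ) : ℂ) := by
    rw [← diagonal_smul]
    congr 1
    funext i
    simp only [Pi.smul_apply, smul_eq_mul]
    push_cast
    ring
  rw [h, Matrix.exp_diagonal, Pi.exp_def]
  congr 1
  funext i
  rw [← Complex.exp_eq_exp_ℂ, Complex.ofReal_exp]

/-- `Re Tr e^{−β diag(E)} = Σ_i e^{−βE_i}`. [folklore] -/
private theorem partitionFn_diagonal_re' (β : ℝ) (E : n → ℝ) :
    (partitionFn β (diagonal fun i => (E i : ℂ))).re = ∑ i, Real.exp (-(β * E i)) := by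
  rw [partitionFn, gibbsWeight_diagonal', trace_diagonal, ← Complex.ofReal_sum, Complex.ofReal_re]

/-- **The near-optimal entropy witness.** For a density matrix `ρ` (positive semidefinite, trace one) and
`ε > 0` there is a Hermitian `G` with `Re tr(ρG) + log Re Tr e^{−G} ≤ S(ρ) + ε`: in an eigenbasis of `ρ` take
`G = diag(g)`, `g_i = −log p_i` on the support (`p_i > 0`) and `g_i = M` off it; then `Re tr(ρG) = S(ρ)` exactly and
`Tr e^{−G} = Σ_{p_i>0} p_i + #{p_i = 0}·e^{−M} ≤ 1 + |n|e^{−M}`. Together with Gibbs' inequality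
(`IsHermitian.vonNeumannEntropy_sub_mul_le_log_partitionFn` at `β = 1`) this says `S(ρ) = inf_G [Re tr(ρG) + log Tr e^{−G}]`.
[cite: NielsenChuang2010, §11.3 eq. (11.40)] -/
theorem exists_isHermitian_witness_le_vonNeumannEntropy_add {ρ : Matrix n n ℂ} (hρ : ρ.PosSemidef)
    (htr : ρ.trace = 1) {ε : ℝ} (hε : 0 < ε) :
    ∃ G : Matrix n n ℂ, G.IsHermitian ∧
      (ρ * G).trace.re + Real.log (partitionFn 1 G).re ≤ vonNeumannEntropy ρ + ε := by
  haveI : Nonempty n := by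
    by_contra h
    rw [not_nonempty_iff] at h
    have : ρ.trace = 0 := by simp [Matrix.trace]
    rw [htr] at this
    exact one_ne_zero this
  set V : Matrix n n ℂ := (hρ.1.eigenvectorUnitary : Matrix n n ℂ) with hV
  have hVu : V ∈ unitary (Matrix n n ℂ) := hρ.1.eigenvectorUnitary.prop
  set p : n → ℝ := hρ.1.eigenvalues with hp
  have hp0 : ∀ i, 0 ≤ p i := fun i => hρ.eigenvalues_nonneg i
  have hp1 : ∑ i, p i = 1 := sum_eigenvalues_eq_one hρ.1 htr
  set N : ℝ := (Fintype.card n : ℝ) with hN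
  have hNpos : 0 < N := by rw [hN]; exact_mod_cast Fintype.card_pos
  -- the large constant and the witness eigenvalues
  set M : ℝ := Real.log ((N + 1) / ε) with hM
  have heM : Real.exp (-M) = ε / (N + 1) := by
    rw [hM, Real.exp_neg, Real.exp_log (div_pos (by linarith) hε), inv_div]
  set g : n → ℝ := fun i => if 0 < p i then -Real.log (p i) else M with hg
  set D : Matrix n n ℂ := diagonal fun i => (g i : ℂ) with hD
  have hDh : D.IsHermitian := by
    rw [hD]
    exact isHermitian_diagonal_of_self_adjoint _ (funext fun i => by simp [Pi.star_apply, Complex.conj_ofReal])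
  set G : Matrix n n ℂ := V * D * star V with hG
  have hGh : G.IsHermitian := by
    have h := isHermitian_mul_mul_conjTranspose V hDh
    rwa [← star_eq_conjTranspose] at h
  refine ⟨G, hGh, ?_⟩
  -- `Re tr(ρG) = Σ p_i g_i = S(ρ)`
  have hDiag : star V * G * V = D := by
    rw [hG]
    simp only [Matrix.mul_assoc, Unitary.star_mul_self_of_mem hVu, Matrix.mul_one]
    rw [← Matrix.mul_assoc, Unitary.star_mul_self_of_mem hVu, Matrix.one_mul]
  have hE : (ρ * G).trace.re = ∑ i, p i * g i := by
    have h1 : (ρ * G).trace = (diagonal (fun i => (p i : ℂ)) * D).trace := by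
      conv_lhs => rw [hρ.1.eq_conj_diagonal]
      rw [trace_unitary_conj_mul, hDiag]
    rw [h1, hD, diagonal_mul_diagonal, trace_diagonal, Complex.re_sum]
    refine sum_congr rfl fun i _ => ?_
    rw [← Complex.ofReal_mul, Complex.ofReal_re]
  have hpg : ∀ i, p i * g i = Real.negMulLog (p i) := by
    intro i
    by_cases hi : 0 < p i
    · simp only [hg, if_pos hi, Real.negMulLog]; ring
    · have h0 : p i = 0 := le_antisymm (not_lt.1 hi) (hp0 i)
      simp only [h0, zero_mul, Real.negMulLog_zero]
  have hS : (ρ * G).trace.re = vonNeumannEntropy ρ := by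
    rw [hE, vonNeumannEntropy_eq hρ.1, ← hp]
    exact sum_congr rfl fun i _ => hpg i
  -- `Re Tr e^{−G} = Σ e^{−g_i} ≤ 1 + N e^{−M}`
  have hZ : (partitionFn 1 G).re = ∑ i, Real.exp (-(g i)) := by
    rw [hG, partitionFn_unitary_conj hVu 1 D, hD, partitionFn_diagonal_re']
    simp only [one_mul]
  have hterm : ∀ i, Real.exp (-(g i)) ≤ p i + Real.exp (-M) := by
    intro i
    by_cases hi : 0 < p i
    · simp only [hg, if_pos hi, neg_neg, Real.exp_log hi]
      linarith [Real.exp_pos (-M)]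
    · have h0 : p i = 0 := le_antisymm (not_lt.1 hi) (hp0 i)
      simp only [hg, if_neg hi, h0, zero_add, le_refl]
  have hZle : (partitionFn 1 G).re ≤ 1 + N * Real.exp (-M) := by
    rw [hZ]
    calc ∑ i, Real.exp (-(g i)) ≤ ∑ i, (p i + Real.exp (-M)) := sum_le_sum fun i _ => hterm i
      _ = 1 + N * Real.exp (-M) := by
          rw [sum_add_distrib, hp1, sum_const, card_univ, nsmul_eq_mul, hN]
  have hZpos : 0 < (partitionFn 1 G).re := by
    rw [hZ]; exact sum_pos (fun i _ => Real.exp_pos _) univ_nonempty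
  have hNe : N * Real.exp (-M) ≤ ε := by
    rw [heM, mul_div_assoc']
    rw [div_le_iff₀ (by linarith)]
    nlinarith [hε.le]
  have hlog : Real.log (partitionFn 1 G).re ≤ ε := by
    calc Real.log (partitionFn 1 G).re ≤ (partitionFn 1 G).re - 1 := Real.log_le_sub_one_of_pos hZpos
      _ ≤ ε := by linarith
  rw [hS]
  linarith

/-- **Reading form**: a lower bound valid against EVERY Hermitian witness is a lower bound on the entropy:
if `c ≤ Re tr(ρG) + log Re Tr e^{−G}` for all Hermitian `G`, then `c ≤ S(ρ)`. [cite: NielsenChuang2010, §11.3 eq. (11.40)] -/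
theorem le_vonNeumannEntropy_of_forall_witness {ρ : Matrix n n ℂ} (hρ : ρ.PosSemidef) (htr : ρ.trace = 1) {c : ℝ}
    (h : ∀ G : Matrix n n ℂ, G.IsHermitian → c ≤ (ρ * G).trace.re + Real.log (partitionFn 1 G).re) :
    c ≤ vonNeumannEntropy ρ := by
  refine le_of_forall_pos_le_add fun ε hε => ?_
  obtain ⟨G, hG, hle⟩ := exists_isHermitian_witness_le_vonNeumannEntropy_add hρ htr hε
  exact (h G hG).trans hle

/-- **Gibbs' inequality for a witness** (`β = 1` form): `S(ρ) ≤ Re tr(ρG) + log Re Tr e^{−G}` for every Hermitian `G`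
and density matrix `ρ`. [cite: NielsenChuang2010, §11.3 eq. (11.40)] -/
theorem vonNeumannEntropy_le_witness {ρ : Matrix n n ℂ} (hρ : ρ.PosSemidef) (htr : ρ.trace = 1) {G : Matrix n n ℂ}
    (hG : G.IsHermitian) : vonNeumannEntropy ρ ≤ (ρ * G).trace.re + Real.log (partitionFn 1 G).re := by
  have h := hG.vonNeumannEntropy_sub_mul_le_log_partitionFn 1 hρ htr
  linarith

end Matrix

end
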